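import Literature.NumberTheory.GaloisRepresentations.GlobalReciprocityArtinTheta
import Literature.NumberTheory.GaloisRepresentations.GlobalReciprocityModPowers
import HarnessLib

/-!
# THE universal norm residue symbol `θ = lim ψ_{L|K}`: the existence theorem in kernel form, and `m`-th powers
# (Neukirch, *Bonn Lectures* III (7.8), (7.12); Tate, C–F VII §5.1 (D))

Topic `NumberTheory/GaloisRepresentations`; namespace `Literature.NumberTheory.GaloisRepresentations`.  Theorems only (no
definition, no named fact, no instance, no notation, no `sorry`); number fields in `Type`.  Sequel to
`GlobalReciprocityArtinTheta` (door-c6 g13: `isGlobalReciprocityMap_artinTheta` — THE limit `θ` of the Artin maps is a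
global reciprocity map) and door-c6 g11's `GlobalReciprocityModPowers` (consequences of `IsGlobalReciprocityMap` mod `m`-th
powers), read on the named map `θ`:

* §1 **`exists_ker_artinMapFamily_eq_one_imp_of_isFiniteOrder`** — every Hecke character of finite order is killed by the
  kernel of some finite-level Artin map `ψ_{L|K}` (the "(HG)" input of the tree's reciprocity-law files, discharged by the Key
  Lemma as in `isGlobalReciprocityMap_artinTheta`); **`exists_ker_artinMapFamily_le`** — THE EXISTENCE THEOREM in kernel form:
  every open subgroup of finite index of `C_K` contains `ker ψ_{M|K}` for some finite abelian `M ⊆ K̄`.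
* §2 **`artinTheta_surjective`**, **`artinTheta_eq_one_iff`** (kernel = divisible classes),
  **`mem_range_pow_iff_artinTheta_mem`** (`a ∈ C_Kᵐ ↔ θ a ∈ (Γ_K^{ab})ᵐ` — Milne I Thm. 1.8 (b)'s input
  `α¹(Γ_K, ℤ/m)` injective, for THE map `θ`), `artinTheta_mem_range_pow_iff_forall_character`.

HONEST FRAMING: classical; corollaries of tree theorems; written for Route A (A5) of crux `AnticycControlAdditiveK` (cell
bsd-schneider): with `IdeleClassCarryInvariantTheta` (`carryInv_eq_zero_iff_theta_mem`) these are the arithmetic inputs of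
Milne I Thm. 1.8 (b) for the class formation `(Γ_K, C̄)` in finite-cyclic-layer currency.

## References
* J. Neukirch, *Class Field Theory — The Bonn Lectures* (2013), Part III §7 Thm. (7.8), Thm. (7.12). [Neukirch2013]
* J. W. S. Cassels, A. Fröhlich (eds.), *Algebraic Number Theory* (1967), Ch. VII (J. Tate) §5.1 Main Theorem (D), §5.6.
  [CasselsFrohlichANT1967]
* J. S. Milne, *Arithmetic Duality Theorems* (2006), I Thm. 1.8 (b) (the use). [MilneADT2006]
-/

noncomputable section

open scoped NumberField
open NumberField IsDedekindDomain Field Filter Polynomial Function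

namespace Literature.NumberTheory.GaloisRepresentations

variable {K : Type} [Field K] [NumberField K]

/-! ## §1. The existence theorem in kernel form -/

/-- **(HG) discharged: every Hecke character of finite order is trivial on `ker ψ_{L|K}` for some finite abelian `L ⊆ K̄`**
(it is the Hecke character of a character of a finite abelian layer: Key Lemma `exists_cyclic_charHecke_of_pow_prime_eq_one`
+ `galoisHecke_of_keyLemma` + Artin reciprocity for characters).
[cite: Neukirch2013, Part III §7 Thm. (7.7), (7.8)][cite: CasselsFrohlichANT1967, Ch. VII §5.1 Main Theorem (B), (D), §12] -/
theorem exists_ker_artinMapFamily_eq_one_imp_of_isFiniteOrder (η : HeckeCharacter K) (hη : η.IsFiniteOrder) :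
    ∃ (L : IntermediateField K (AlgebraicClosure K)) (_ : FiniteDimensional K L) (_ : IsAbelianGalois K L),
      ∀ x : ideleGroup K, artinMapFamily K artinReciprocity_character_holds L (QuotientGroup.mk x) = 1 → η x = 1 := by
  obtain ⟨L, hL, hab, χ, hηχ⟩ := galoisHecke_of_keyLemma artinReciprocity_character_holds
    exists_cyclic_charHecke_of_pow_prime_eq_one (orderOf η) K η rfl hη
  haveI := hL
  haveI := hab
  haveI : NumberField L := NumberField.of_module_finite K L
  refine exists_forall_artinMapFamily_eq_one_imp_of_eventually artinReciprocity_character_holds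
    (ρ := inflateCharacter L χ) ?_
  filter_upwards [eventually_isUnramifiedIn (K := K) L] with v hunr _
  rw [hηχ, charHecke_valueAtUniformizer L χ _ hunr]
  exact inflateCharacter_hasFrobCharpolyAt L χ (commute_of_isAbelianGalois L) hunr

/-- **THE EXISTENCE THEOREM (kernel form, unconditional)**: every open subgroup of finite index of `C_K` contains the
kernel of the Artin map `ψ_{M|K} : C_K → Gal(M|K)` of some finite abelian `M ⊆ K̄` (so it is a norm group).
[cite: Neukirch2013, Part III §7 Thm. (7.8)][cite: CasselsFrohlichANT1967, Ch. VII §5.1 Main Theorem (D)] -/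
theorem exists_ker_artinMapFamily_le (N : Subgroup (ideleGroup K ⧸ principalIdeles K))
    (hN : IsOpen (N : Set (ideleGroup K ⧸ principalIdeles K))) (hfi : N.FiniteIndex) :
    ∃ (M : IntermediateField K (AlgebraicClosure K)) (_ : FiniteDimensional K M) (_ : IsAbelianGalois K M),
      (artinMapFamily K artinReciprocity_character_holds M).ker ≤ N :=
  exists_ker_artinMapFamily_le_of_forall_isFiniteOrder artinReciprocity_character_holds
    (fun η hη => exists_ker_artinMapFamily_eq_one_imp_of_isFiniteOrder η hη) N hN hfi

/-! ## §2. `θ` is onto, its kernel is the divisible classes, and `a ∈ C_Kᵐ ↔ θ a ∈ (Γ_K^{ab})ᵐ` -/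

/-- **`θ : C_K → Γ_K^{ab}` is surjective.** [cite: Neukirch2013, Part III Thm. (7.12)][cite: CasselsFrohlichANT1967, Ch. VII §5.6] -/
theorem artinTheta_surjective (K : Type) [Field K] [NumberField K] :
    Surjective (isCompatibleSystem_artinMapFamily (K := K) artinReciprocity_character_holds).theta :=
  (isGlobalReciprocityMap_artinTheta K).surjective

/-- **`θ a = 1 ↔ a` is infinitely divisible** (`ker θ = D_K = ⋂ₙ C_Kⁿ`). [cite: Neukirch2013, Part III Thm. (7.12)] -/
theorem artinTheta_eq_one_iff (a : ideleGroup K ⧸ principalIdeles K) :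
    (isCompatibleSystem_artinMapFamily (K := K) artinReciprocity_character_holds).theta a = 1 ↔
      ∀ n : ℕ, 0 < n → ∃ b : ideleGroup K ⧸ principalIdeles K, b ^ n = a :=
  (isGlobalReciprocityMap_artinTheta K).map_eq_one_iff a

/-- **`a ∈ C_Kᵐ ↔ θ a ∈ (Γ_K^{ab})ᵐ`** (`m ≥ 1`) — the injectivity of Milne's `α¹(Γ_K, ℤ/m) : C_K/m → Hom(H¹(Γ_K, ℤ/m), ℚ/ℤ)`
for THE reciprocity map (door-c6 g11's `IsGlobalReciprocityMap.map_mem_range_powMonoidHom_iff` on `θ`).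
[cite: Neukirch2013, Part III Thm. (7.12)][cite: MilneADT2006, I Thm. 1.8 (b)] -/
theorem mem_range_pow_iff_artinTheta_mem {m : ℕ} (hm : 0 < m) (a : ideleGroup K ⧸ principalIdeles K) :
    a ∈ (@powMonoidHom (ideleGroup K ⧸ principalIdeles K) _ m).range ↔
      (isCompatibleSystem_artinMapFamily (K := K) artinReciprocity_character_holds).theta a ∈
        (@powMonoidHom (absoluteGaloisGroupAbelianization K) _ m).range :=
  ((isGlobalReciprocityMap_artinTheta K).map_mem_range_powMonoidHom_iff hm a).symm

/-- **`a ∈ C_Kᵐ ↔` every continuous `ℚ/ℤ`-character of `Γ_K^{ab}` killed on `m`-th powers kills `θ a`.**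
[cite: Neukirch2013, Part III Thm. (7.12)][cite: MilneADT2006, I Thm. 1.8 (b)] -/
theorem mem_range_pow_iff_forall_character_artinTheta {m : ℕ} (hm : 0 < m) (a : ideleGroup K ⧸ principalIdeles K) :
    a ∈ (@powMonoidHom (ideleGroup K ⧸ principalIdeles K) _ m).range ↔
      ∀ χ : contOneCocycles
          (ContinuousRep.trivial (absoluteGaloisGroupAbelianization K) ℤ QModZCoeff.{0}).toTopRep,
        (∀ g : absoluteGaloisGroupAbelianization K, χ.1 (g ^ m) = 0) →
          χ.1 ((isCompatibleSystem_artinMapFamily (K := K) artinReciprocity_character_holds).theta a) = 0 :=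
  (isGlobalReciprocityMap_artinTheta K).mem_range_pow_iff_forall_character hm a

end Literature.NumberTheory.GaloisRepresentations

end
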